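import Summits.HodgeConjecture.HodgeConjecture.Theses.ELineTransport
import Literature.AlgebraicGeometry.HodgeTheory.ComplexGysin
import Literature.AlgebraicGeometry.HodgeTheory.GysinKernelProofs
import Literature.AlgebraicGeometry.Motives.ComplexPointsOrientation
import HarnessLib

/-!
# Route ELineTransport — `IsogenyInvariance` (item stmt-HodgeConjecture-12550): the typed split into three pieces

The deciding crux `IsogenyInvariance` (transport principle: HC(S₁ × S₁) for a projective K3 surface
`S₁` with an E-structure `J₁` satisfying EX and TC which is E-isometric, through `(g, g₄)`, to a
Picard-18 anchor `(S₀, J₀)` with HC(S₀ × S₀)) is concluded BY NAME from the three route items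

* `SquareHodgeOfEClass` (stmt-HodgeConjecture-19047) — Künneth bookkeeping under EX: if the class
  of `J` is induced by an algebraic class `γ ∈ algebraicClasses (S ⊗ S) 2` through the Gysin
  correspondence action `x ↦ fst_* (snd^* x ∪ γ)`, then `HodgeConjectureFor 4 (S ⊗ S)`;
* `EClassOfSquareHodge` (stmt-HodgeConjecture-19048) — conversely `HodgeConjectureFor 4 (S ⊗ S)`
  makes the class of an E-structure algebraic (no EX: used at the CM anchor, where EX fails);
* `EClassTransport` (stmt-HodgeConjecture-19049) — the transport proper: algebraicity of the
  E-class moves along an E-isometry from a Picard-18 anchor to `S₁` under TC.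

The assembly is not a conjunction seam: the crux hands the anchor `J₀` only with its `(2,0)`-clause,
so the E-structure of `S₁` is first TRANSPORTED to `S₀` through the E-isometry (rationality of `J₀`
from `g` rational both ways, `J₀ ∘ J₀ = m` and cup-self-adjointness from `g J₁ = J₀ g` and
`g₄ (a ∪ b) = g a ∪ g b`); an orientation family with Poincaré duality is produced from the tree
(`Motives.ComplexPoints.isOrientableOver`, `OrientationFamily.hasPoincareDuality`); then
`EClassOfSquareHodge` is applied at the anchor, `EClassTransport` along `(g, g₄)`, and
`SquareHodgeOfEClass` at the target under EX. This is the glue consumed by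
`ledger route edit route-HodgeConjecture-ELineTransport --split IsogenyInvariance --into
SquareHodgeOfEClass EClassOfSquareHodge EClassTransport --glue-by
Summit.HodgeConjecture.HodgeConjecture.Theorems.isogenyInvariance_of_pieces` (crux-strategist; THIS copy lives in the crux
workfile namespace `…Cruxes.IsogenyInvariance.Split` — the Theorems-namespace original is the evidence file
`ELineTransportIsogenyInvarianceSplit.lean` on stmt-12550, to be landed by a prover;
BC2 redirect of the RESTATED deciding crux).
-/

set_option linter.dupNamespace false

namespace Summit.HodgeConjecture.HodgeConjecture.Cruxes.IsogenyInvariance.Split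

open Summit.HodgeConjecture.HodgeConjecture.Theses.ELineTransport

/-- ASSEMBLY of the typed split of `ELineTransport.IsogenyInvariance` (stmt-HodgeConjecture-12550):
the three pieces `SquareHodgeOfEClass` (19047), `EClassOfSquareHodge` (19048), `EClassTransport`
(19049) imply the crux. The E-structure of the target is transported to the anchor through the
E-isometry `(g, g₄)`; an orientation family with Poincaré duality exists by the tree's theorems. -/
theorem isogenyInvariance_of_pieces (h₁ : SquareHodgeOfEClass) (h₂ : EClassOfSquareHodge)
    (h₃ : EClassTransport) : IsogenyInvariance := by
  intro S₀ S₁ hS₀ hS₁ m hm J₀ J₁ hJ₀ hJ₁ hrk hg hHC₀ hEX hTC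
  -- an orientation family with Poincaré duality (the complex points of a smooth projective variety are orientable;
  -- Poincaré duality is a theorem of the tree)
  obtain ⟨μ, hμ⟩ : ∃ μ : Literature.AlgebraicGeometry.HodgeTheory.OrientationFamily, μ.HasPoincareDuality :=
    ⟨fun _ _ h ↦ Classical.choice (Literature.AlgebraicGeometry.Motives.ComplexPoints.isOrientableOver ℂ h),
      Literature.AlgebraicGeometry.HodgeTheory.OrientationFamily.hasPoincareDuality _⟩
  obtain ⟨g, g₄, hgr, hgJ, hgc, hgi⟩ := hg
  obtain ⟨hJ₁r, hJ₁sq, hJ₁sa, hJ₁σ⟩ := hJ₁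
  -- the E-structure of `S₁` transports to the anchor `S₀` through the E-isometry `(g, g₄)`
  have hJ₀r : ∀ c, Literature.AlgebraicGeometry.HodgeTheory.IsRationalClass c →
      Literature.AlgebraicGeometry.HodgeTheory.IsRationalClass (J₀ c) := by
    intro c hc
    have h1 : Literature.AlgebraicGeometry.HodgeTheory.IsRationalClass (g.symm c) := by
      rw [hgr, LinearEquiv.apply_symm_apply]; exact hc
    have h2 := (hgr _).1 (hJ₁r _ h1)
    rwa [hgJ, LinearEquiv.apply_symm_apply] at h2
  have hJ₀sq : ∀ c, J₀ (J₀ c) = (m : ℂ) • c := by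
    intro c
    obtain ⟨c', rfl⟩ := g.surjective c
    rw [← hgJ, ← hgJ, hJ₁sq, map_smul]
  have hJ₀sa : ∀ a b, Literature.AlgebraicTopology.SingularHomology.cupProduct rfl (J₀ a) b =
      Literature.AlgebraicTopology.SingularHomology.cupProduct rfl a (J₀ b) := by
    intro a b
    obtain ⟨a', rfl⟩ := g.surjective a
    obtain ⟨b', rfl⟩ := g.surjective b
    rw [← hgJ, ← hgc, hJ₁sa, hgc, hgJ]
  have hJ₀E := And.intro hJ₀r (And.intro hJ₀sq (And.intro hJ₀sa hJ₀))
  -- `EClassOfSquareHodge` at the anchor: HC(S₀ × S₀) makes the class of `J₀` algebraic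
  have hγ₀ := h₂ μ hμ S₀ hS₀ m hm J₀ hJ₀E hHC₀
  -- `EClassTransport`: transport of the algebraic E-class along the E-isometry to `S₁`
  have hγ₁ := h₃ μ hμ S₀ S₁ hS₀ hS₁ m hm J₀ J₁ hJ₀E ⟨hJ₁r, hJ₁sq, hJ₁sa, hJ₁σ⟩ hrk
    ⟨g, g₄, hgr, hgJ, hgc, hgi⟩ hTC hγ₀
  -- `SquareHodgeOfEClass` at the target: Künneth bookkeeping under EX
  exact h₁ μ hμ S₁ hS₁ m hm J₁ ⟨hJ₁r, hJ₁sq, hJ₁sa, hJ₁σ⟩ hEX hγ₁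

/-- The same assembly in the `C₁ → … → C_k → C` shape the split glue expects (curried, no binders). -/
theorem IsogenyInvariance_of_subs :
    SquareHodgeOfEClass → EClassOfSquareHodge → EClassTransport → IsogenyInvariance :=
  isogenyInvariance_of_pieces

end Summit.HodgeConjecture.HodgeConjecture.Cruxes.IsogenyInvariance.Split
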